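import Literature.Topology.FourManifolds.TwoSidedSurfaceDetour
import Literature.Topology.FourManifolds.BandSumConcordanceNormalRegular
import Literature.Topology.FourManifolds.ConcordanceToFlatAnnulus
import Literature.Topology.FourManifolds.LongAnnulusFlatStrip
import Literature.Topology.FourManifolds.KnotsProofs
import Literature.Topology.FourManifolds.KnotsIsotopyProofs
import HarnessLib

/-!
# Concordance is compatible with connected sum: both factors at once (Fox–Milnor)

Topic `Literature/Topology/FourManifolds`; the discharge of the named fact
`Literature.Topology.FourManifolds.Knot.exists_isConnectedSum_isConcordant`
(`BandSumConcordance.lean`): if `K₁ ~c K₁'` and `K₂ ~c K₂'` then some connected sums `K₁ # K₂`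
and `K₁' # K₂'` are concordant. Everything here is proved; no named fact is introduced.

The proof is Fox–Milnor's carrying construction performed on **both** factors without any
uniqueness of the connected sum: the first concordance, made conical, carries a good tube along a
spanning arc (`ConcordanceStripTubeGeometry.lean`); the second concordance is charted and
straightened into a long annulus with a flat strip (`IsConcordant.exists_flat_longAnnulus`,
`LongAnnulus.exists_flat_strip`), inverted next to the strip so that its moving body becomes a
small blob hanging on a static ring (`InvertedPicture.lean`, `InvertedModel.lean`), and inserted
into the tube as a surface detour (`StripPicture.surfaceDetour`,
`TwoSidedSurfaceDetour.lean`); the strip replacement (`ConcordanceSurfaceReplacement.lean`)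
is then a concordance whose ends are the detours of the two inverted end knots, recognised as
regular normal connected sums by the transport theorem
(`KnotPiece.InTube.exists_isRegularNormalConnectedSum_of_transport`), exactly as in the
one-factor theorem `exists_isRegularNormalConnectedSum_isConcordant`
(`BandSumConcordanceNormalRegular.lean`), whose choice of sizes is repeated here.

## References

* R. H. Fox, J. W. Milnor, *Singularities of 2-spheres in 4-space and cobordism of knots*, Osaka
  J. Math. 3 (1966), 257–267, §1. [FoxMilnor1966]
* P. R. Cromwell, *Knots and Links* (2004), §4.6. [Cromwell2004]

## Design notes

No named facts, no `sorry`.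
-/

open Set Function Metric
open scoped Topology ContDiff Manifold RealInnerProductSpace Real

noncomputable section

namespace Literature.Topology.FourManifolds

attribute [local instance] fact_finrank_euclideanSpace_two fact_finrank_euclideanSpace_four

namespace Knot.IsConicalConcordance

open KnotsInBall StripFrame BandFoliation ChartData KnotPiece AffineIsotopy

variable {K K' : Knot} {f : (sphere (0 : EuclideanSpace ℝ (Fin 2)) 1) × ℝ → EuclideanSpace ℝ (Fin 4)} {δ : ℝ}
  (h : IsConicalConcordance K K' f δ) {w : EuclideanSpace ℝ (Fin 4)}
  {η ε : ℝ}

/-- **The two-sided carrying construction for given sizes, regular normally presented ends.**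
As `exists_isRegularNormalConnectedSum_isConcordant_of_model`, with the product detour of the
static small knot replaced by the two-sided surface detour of a flat-strip long annulus: the ends
are regular normal connected sums of `K` with the inverted lower end knot and of `K'` with the
inverted upper end knot, and they are concordant. [cite: FoxMilnor1966, §1] -/
theorem exists_isRegularNormalConnectedSum_isConcordant_of_strip (G : (h.setup w).GoodTube 0 η ε)
    {ηD : ℝ} {Dl : LongAnnulus ηD} (S : StripPicture Dl)
    (sg : ℝ) (hsg : sg ^ 2 = 1) (am l δ' : ℝ) (ham : 0 < am) (hl : 0 < l) (hδ : 0 < δ') (hδ8 : δ' ≤ 1 / 8)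
    (hl_le : 16 * l * (‖S.x₀‖ + 2 * S.a + 1) ≤ am)
    (hδ_room : δ' * (16 * am * (‖S.x₀‖ + 2 * S.a + 1)) ≤ l)
    (hδ_up : δ' * (16 * (‖S.x₀‖ + 2 * S.a + 1) ^ 2) < 1)
    (hδ_clean : δ' * (2 * am) ≤ l * (S.a / 4))
    (hη1 : η ≤ 1) (hℓη : l * S.ℓ ≤ η / 8) (hρη : 8 * l * (‖S.x₀‖ + 2 * S.a + 1) ≤ η) (haε : 2 * am < ε)
    (F₁ F₂ : AmbientIsotopy 𝓘(ℝ, EuclideanSpace ℝ (Fin 3)) (EuclideanSpace ℝ (Fin 3)))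
    (hF₁ : ∀ z ∈ closedBall (0 : EuclideanSpace ℝ (Fin 3)) (‖S.x₀‖ + 2 * S.a + 1),
      F₁.toFun 1 z = h.g₁ w ((S.md sg hsg am l δ' ham hl hδ hδ8 hl_le hδ_room hδ_up hδ_clean).T z)) {R₁ : ℝ}
    (hR₁ : ∀ t (y : EuclideanSpace ℝ (Fin 3)), R₁ ≤ ‖y‖ → F₁.toFun t y = y)
    (hF₂ : ∀ z ∈ closedBall (0 : EuclideanSpace ℝ (Fin 3)) (‖S.x₀‖ + 2 * S.a + 1),
      F₂.toFun 1 z = h.g₂ w ((S.md sg hsg am l δ' ham hl hδ hδ8 hl_le hδ_room hδ_up hδ_clean).T z)) {R₂ : ℝ}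
    (hR₂ : ∀ t (y : EuclideanSpace ℝ (Fin 3)), R₂ ≤ ‖y‖ → F₂.toFun t y = y)
    (hTW : ∀ z ∈ closedBall (0 : EuclideanSpace ℝ (Fin 3)) (‖S.x₀‖ + 2 * S.a + 1),
      (S.md sg hsg am l δ' ham hl hδ hδ8 hl_le hδ_room hδ_up hδ_clean).T z ∈ h.W₁ w ∩ h.W₂ w) :
    ∃ L L' : Knot, IsRegularNormalConnectedSum K S.Kn₁ L ∧ IsRegularNormalConnectedSum K' S.Kn₂ L' ∧
      L.IsConcordant L' := by
  set md := S.md sg hsg am l δ' ham hl hδ hδ8 hl_le hδ_room hδ_up hδ_clean with hmd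
  have hρ' : (0 : ℝ) < ‖S.x₀‖ + 2 * S.a + 1 := by have := S.a_pos; positivity
  have hρ'eq : md.ρ' = ‖S.x₀‖ + 2 * S.a + 1 := rfl
  have hℓη' : md.l * md.ℓ ≤ η / 8 := hℓη
  have hρη' : 8 * md.l * md.ρ' ≤ η := hρη
  have haε' : 2 * md.a < ε := haε
  -- the tube fits, the detours and the surface detour
  have hfit₁ : md.piece.TubeFit η ε := S.tubeFit₁ sg hsg am l δ' ham hl hδ hδ8 hl_le hδ_room hδ_up hδ_clean hη1 hℓη hρη haε
  have hfit₂ := S.tubeFit₂' sg hsg am l δ' ham hl hδ hδ8 hl_le hδ_room hδ_up hδ_clean hη1 hℓη hρη haε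
  set Dt₁ := KnotPiece.detour hfit₁ with hDt₁
  set Dt₂ := KnotPiece.detour hfit₂ with hDt₂
  set Dc := S.surfaceDetour sg hsg am l δ' ham hl hδ hδ8 hl_le hδ_room hδ_up hδ_clean hη1 hℓη hρη haε with hDc
  -- `T` maps the chart images into the region
  have hT₁ : ∀ y, affT md.x₀ md.p md.M md.l (psi (S.Kn₁ y)) ∈ region 0 η ε := fun y ↦
    (md.T_mem hρη' haε' (ball_subset_closedBall (md.psi_mem_ball y))).2.2.2
  have hT₂ : ∀ y, affT md.x₀ md.p md.M md.l (psi (S.Kn₂ y)) ∈ region 0 η ε := fun y ↦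
    (md.T_mem hρη' haε' (ball_subset_closedBall (S.psi_Kn₂_mem_ball y))).2.2.2
  -- the knots
  set tiny₁ := h.tinyKnot₁ (w := w) G md.hKn md.l_pos.ne' hT₁ with htiny₁
  set tiny₂ := h.tinyKnot₂ (w := w) G S.Kn₂_ne_southPole md.l_pos.ne' hT₂ with htiny₂
  set N₁ := h.surfKnot₁ Dc G with hN₁
  set N₂ := h.surfKnot₂ Dc G with hN₂
  have hN₁eq : N₁ = h.newKnot₁ Dt₁ G :=
    h.surfKnot₁_eq_newKnot₁ (w := w) Dc G Dt₁
      (S.surfaceDetour_c_one sg hsg am l δ' ham hl hδ hδ8 hl_le hδ_room hδ_up hδ_clean hη1 hℓη hρη haε)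
  have hN₂eq : N₂ = h.newKnot₂ Dt₂ G :=
    h.surfKnot₂_eq_newKnot₂ (w := w) Dc G Dt₂
      (S.surfaceDetour_c_two sg hsg am l δ' ham hl hδ hδ8 hl_le hδ_room hδ_up hδ_clean hη1 hℓη hρη haε)
  -- the two band-sum configurations
  have in₁ : md.piece.InTube (h.endFrame₁ G) K tiny₁ N₁ :=
    { fit := hfit₁
      lo3 := md.lo3 hℓη'
      hi3 := md.hi3 hℓη'
      hKend := fun u ↦ h.coe_K_circlePt u
      htiny := fun θ ↦ by
        rw [htiny₁, h.coe_tinyKnot₁, endFrame₁_c, ModelData.piece_k, ModelData.k_apply]; rfl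
      hKnew := fun u ↦ by
        rw [hN₁eq, circlePt_eq_circlePoint, h.coe_newKnot₁_circlePoint, mul_div_cancel_left₀ _ (by positivity),
          endFrame₁_c]
        rfl
      separated := fun x hx hd u he' ↦ h.separated₁ G x hx hd u he'
      clean := md.clean }
  have in₂ : (S.piece₂ sg hsg am l δ' ham hl hδ hδ8 hl_le hδ_room hδ_up hδ_clean).InTube (h.endFrame₂ G) K' tiny₂ N₂ :=
    { fit := hfit₂
      lo3 := md.lo3 hℓη'
      hi3 := md.hi3 hℓη'
      hKend := fun u ↦ h.coe_K'_circlePt u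
      htiny := fun θ ↦ by
        rw [htiny₂, h.coe_tinyKnot₂, endFrame₂_c, StripPicture.piece₂_k]; rfl
      hKnew := fun u ↦ by
        rw [hN₂eq, circlePt_eq_circlePoint, h.coe_newKnot₂_circlePoint, mul_div_cancel_left₀ _ (by positivity),
          endFrame₂_c]
        rfl
      separated := fun x hx hd u he' ↦ h.separated₂ G x hx hd u he'
      clean := S.clean₂ sg hsg am l δ' ham hl hδ hδ8 hl_le hδ_room hδ_up hδ_clean }
  -- the transported isotopies on `𝕊³`
  set Θ₁ := F₁.alongChart (φ := psi) contMDiffOn_psi contMDiff_psi_symm psi_target hR₁ with hΘ₁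
  set Θ₂ := F₂.alongChart (φ := psi) contMDiffOn_psi contMDiff_psi_symm psi_target hR₂ with hΘ₂
  have hΘ₁' : ∀ z ∈ closedBall (0 : EuclideanSpace ℝ (Fin 3)) md.ρ',
      Θ₁.toFun 1 (psi.symm z) = (h.endFrame₁ G).cS (md.T z) := by
    intro z hz
    rw [hΘ₁, AmbientIsotopy.alongChart_toFun, chartTransport_of_mem _ (mem_psi_source (psi_symm_ne_southPole z)),
      psi_apply_psi_symm, hF₁ z hz, endFrame₁_cS]
    exact psi_symm_apply_psi (hTW z hz).1
  have hΘ₂' : ∀ z ∈ closedBall (0 : EuclideanSpace ℝ (Fin 3)) md.ρ',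
      Θ₂.toFun 1 (psi.symm z) = (h.endFrame₂ G).cS (md.T z) := by
    intro z hz
    rw [hΘ₂, AmbientIsotopy.alongChart_toFun, chartTransport_of_mem _ (mem_psi_source (psi_symm_ne_southPole z)),
      psi_apply_psi_symm, hF₂ z hz, endFrame₂_cS]
    exact psi_symm_apply_psi (hTW z hz).2
  have hTmaps : MapsTo md.T (closedBall (0 : EuclideanSpace ℝ (Fin 3)) md.ρ') (region 0 η ε) := fun z hz ↦
    (md.T_mem hρη' haε' hz).2.2.2
  -- the regular normal presentations
  have hsum₁ : ∃ N₀, N₁.IsIsotopic N₀ ∧ IsRegularNormalConnectedSum K S.Kn₁ N₀ := by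
    refine in₁.exists_isRegularNormalConnectedSum_of_transport md.hKn md.T hρ' Θ₁ hΘ₁' hTmaps (fun y ↦ ?_)
      md.psi_mem_ball (fun y z hz heq ↦ ?_) (fun x hx ↦ md.B_mem_image_iff hx)
    · apply Subtype.ext; rw [htiny₁, h.coe_tinyKnot₁, endFrame₁_cS, coe_cS₁]; rfl
    · obtain ⟨v, -, rfl⟩ := InTube.exists_window (C := md.chart) y
      obtain ⟨h0, hd, hpos, -⟩ := md.T_mem hρη' haε' hz
      have := (in₁.separated (md.T z) h0 hd v (by rw [heq]; rfl)).1
      linarith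
  have hsum₂ : ∃ N₀, N₂.IsIsotopic N₀ ∧ IsRegularNormalConnectedSum K' S.Kn₂ N₀ := by
    refine in₂.exists_isRegularNormalConnectedSum_of_transport S.Kn₂_ne_southPole md.T hρ' Θ₂ hΘ₂' hTmaps
      (fun y ↦ ?_) S.psi_Kn₂_mem_ball
      (fun y z hz heq ↦ ?_) (fun x hx ↦ md.B_mem_image_iff hx)
    · apply Subtype.ext; rw [htiny₂, h.coe_tinyKnot₂, endFrame₂_cS, coe_cS₂]; rfl
    · obtain ⟨v, -, rfl⟩ := InTube.exists_window (C := md.chart) y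
      obtain ⟨h0, hd, hpos, -⟩ := md.T_mem hρη' haε' hz
      have := (in₂.separated (md.T z) h0 hd v (by rw [heq]; rfl)).1
      linarith
  -- the ends of the surface replacement are concordant
  obtain ⟨L, hL, hLn⟩ := hsum₁
  obtain ⟨L', hL', hL'n⟩ := hsum₂
  have hc : N₁.IsConcordant N₂ := ⟨_, h.isConcordance_surfAnnulus (w := w) Dc G⟩
  exact ⟨L, L', hLn, hL'n, equivalence_isConcordant_holds.trans
    (equivalence_isConcordant_holds.symm (IsConcordant.of_isIsotopic_holds hL))
    (equivalence_isConcordant_holds.trans hc (IsConcordant.of_isIsotopic_holds hL'))⟩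

/-- **The two-sided carrying construction, regular normally presented ends** (the sizes chosen as
in `exists_isRegularNormalConnectedSum_isConcordant`: height, frame sign, linearised transports,
scale, collar width). [cite: FoxMilnor1966, §1] -/
theorem exists_isRegularNormalConnectedSum_isConcordant_twoSided (G : (h.setup w).GoodTube 0 η ε)
    {ηD : ℝ} {Dl : LongAnnulus ηD} (S : StripPicture Dl) :
    ∃ L L' : Knot, IsRegularNormalConnectedSum K S.Kn₁ L ∧ IsRegularNormalConnectedSum K' S.Kn₂ L' ∧
      L.IsConcordant L' := by
  have hε := G.ε_pos
  have hη := G.η_pos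
  have hη4 := G.η_le
  have haS := S.a_pos
  have hℓ := S.ℓ_pos
  -- the bound and the radius of the model
  set Rb : ℝ := ‖S.x₀‖ + 2 * S.a with hRb
  have hRb0 : 0 ≤ Rb := by positivity
  have hρ'pos : 0 < Rb + 1 := by linarith
  -- the height of the band
  obtain ⟨a, ha, hx₁, hx₂⟩ := h.exists_height G
  have ha0 : 0 < a := by linarith [ha.1]
  have hx₀reg : (a • e3 1 : EuclideanSpace ℝ (Fin 3)) ∈ region 0 η ε := by
    refine ⟨by simp [hη], ?_⟩
    simp only [PiLp.smul_apply, e3_apply, smul_eq_mul]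
    simp
    rw [abs_of_pos ha0]; linarith [ha.2]
  -- the frame, oriented compatibly with the lower end chart
  obtain ⟨s, hs, hdet⟩ := exists_frameOf_det_pos (equivOfInjective _ (h.injective_fderiv_g₁ G hx₀reg hx₁)) S.norm_e S.e_two
  rw [coe_equivOfInjective] at hdet
  -- the two linearised transports on the model ball
  have hWo : IsOpen (region 0 η ε ∩ (h.W₁ w ∩ h.W₂ w)) :=
    (isOpen_region 0 η ε).inter ((h.isOpen_W₁ w).inter (h.isOpen_W₂ w))
  have hxW : (a • e3 1 : EuclideanSpace ℝ (Fin 3)) ∈ region 0 η ε ∩ (h.W₁ w ∩ h.W₂ w) := ⟨hx₀reg, hx₁, hx₂⟩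
  have hg₁ : ContDiffOn ℝ ∞ (h.g₁ w) (region 0 η ε ∩ (h.W₁ w ∩ h.W₂ w)) :=
    (h.contDiffOn_g₁ w).mono fun x hx ↦ hx.2.1
  have hg₂ : ContDiffOn ℝ ∞ (h.g₂ w) (region 0 η ε ∩ (h.W₁ w ∩ h.W₂ w)) :=
    (h.contDiffOn_g₂ w).mono fun x hx ↦ hx.2.2
  have hL₁' : HasFDerivAt (h.g₁ w)
      (equivOfInjective _ (h.injective_fderiv_g₁ G hx₀reg hx₁) :
        EuclideanSpace ℝ (Fin 3) →L[ℝ] EuclideanSpace ℝ (Fin 3)) (a • e3 1) := by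
    rw [coe_equivOfInjective]; exact (h.differentiableAt_g₁ hx₁).hasFDerivAt
  have hL₂' : HasFDerivAt (h.g₂ w)
      (equivOfInjective _ (h.injective_fderiv_g₂ G hx₀reg hx₂) :
        EuclideanSpace ℝ (Fin 3) →L[ℝ] EuclideanSpace ℝ (Fin 3)) (a • e3 1) := by
    rw [coe_equivOfInjective]; exact (h.differentiableAt_g₂ hx₂).hasFDerivAt
  have hM₁ : 0 < (toMat ((equivOfInjective _ (h.injective_fderiv_g₁ G hx₀reg hx₁) :
      EuclideanSpace ℝ (Fin 3) →L[ℝ] EuclideanSpace ℝ (Fin 3)).comp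
      (frameOf S.norm_e S.e_two hs : EuclideanSpace ℝ (Fin 3) →L[ℝ] EuclideanSpace ℝ (Fin 3)))).det := by
    rw [coe_equivOfInjective]; exact hdet
  have hM₂ : 0 < (toMat ((equivOfInjective _ (h.injective_fderiv_g₂ G hx₀reg hx₂) :
      EuclideanSpace ℝ (Fin 3) →L[ℝ] EuclideanSpace ℝ (Fin 3)).comp
      (frameOf S.norm_e S.e_two hs : EuclideanSpace ℝ (Fin 3) →L[ℝ] EuclideanSpace ℝ (Fin 3)))).det := by
    rw [coe_equivOfInjective]; exact h.det_toMat_comp_pos G hx₀reg hx₁ hx₂ _ hdet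
  have hZc : IsCompact (closedBall (0 : EuclideanSpace ℝ (Fin 3)) (Rb + 1)) := isCompact_closedBall _ _
  obtain ⟨l₁, hl₁, H₁⟩ := exists_ambientIsotopy_comp_affine hWo hg₁ hxW _ _ hL₁' hM₁ hZc S.x₀
  obtain ⟨l₂, hl₂, H₂⟩ := exists_ambientIsotopy_comp_affine hWo hg₂ hxW _ _ hL₂' hM₂ hZc S.x₀
  -- the scale
  obtain ⟨l, hlpos, hll₁, hll₂, hl_a, hl_η, hl_ℓ⟩ : ∃ l : ℝ, 0 < l ∧ l < l₁ ∧ l < l₂ ∧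
      16 * l * (Rb + 1) ≤ a ∧ 8 * l * (Rb + 1) ≤ η ∧ l * S.ℓ ≤ η / 8 := by
    refine ⟨min (min l₁ l₂ / 2) (min (a / (16 * (Rb + 1))) (min (η / (8 * (Rb + 1))) (η / (8 * S.ℓ)))),
      lt_min (by positivity) (lt_min (by positivity) (lt_min (by positivity) (by positivity))), ?_, ?_, ?_, ?_, ?_⟩
    · have h1 : min (min l₁ l₂ / 2) (min (a / (16 * (Rb + 1))) (min (η / (8 * (Rb + 1))) (η / (8 * S.ℓ)))) ≤
        min l₁ l₂ / 2 := min_le_left _ _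
      have := min_le_left l₁ l₂; linarith
    · have h1 : min (min l₁ l₂ / 2) (min (a / (16 * (Rb + 1))) (min (η / (8 * (Rb + 1))) (η / (8 * S.ℓ)))) ≤
        min l₁ l₂ / 2 := min_le_left _ _
      have := min_le_right l₁ l₂; linarith
    · have h1 : min (min l₁ l₂ / 2) (min (a / (16 * (Rb + 1))) (min (η / (8 * (Rb + 1))) (η / (8 * S.ℓ)))) ≤
        a / (16 * (Rb + 1)) := (min_le_right _ _).trans (min_le_left _ _)
      rw [le_div_iff₀ (by positivity)] at h1; linarith
    · have h1 : min (min l₁ l₂ / 2) (min (a / (16 * (Rb + 1))) (min (η / (8 * (Rb + 1))) (η / (8 * S.ℓ)))) ≤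
        η / (8 * (Rb + 1)) := ((min_le_right _ _).trans (min_le_right _ _)).trans (min_le_left _ _)
      rw [le_div_iff₀ (by positivity)] at h1; linarith
    · have h1 : min (min l₁ l₂ / 2) (min (a / (16 * (Rb + 1))) (min (η / (8 * (Rb + 1))) (η / (8 * S.ℓ)))) ≤
        η / (8 * S.ℓ) := ((min_le_right _ _).trans (min_le_right _ _)).trans (min_le_right _ _)
      rw [le_div_iff₀ (by positivity)] at h1; linarith
  obtain ⟨hTW, F₁, hF₁, R₁, hR₁⟩ := H₁ l ⟨hlpos, hll₁⟩
  obtain ⟨-, F₂, hF₂, R₂, hR₂⟩ := H₂ l ⟨hlpos, hll₂⟩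
  -- the collar width (with `ν = a_S / 4`)
  obtain ⟨δ', hδ'pos, hδ'le, hδ'room, hδ'up, hδ'clean⟩ : ∃ δ' : ℝ, 0 < δ' ∧ δ' ≤ 1 / 8 ∧
      δ' * (16 * a * (Rb + 1)) ≤ l ∧ δ' * (16 * (Rb + 1) ^ 2) < 1 ∧ δ' * (2 * a) ≤ l * (S.a / 4) := by
    have hν : 0 < S.a / 4 := by positivity
    refine ⟨min (1 / 8) (min (l / (16 * a * (Rb + 1))) (min (1 / (32 * (Rb + 1) ^ 2)) (l * (S.a / 4) / (2 * a)))),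
      lt_min (by norm_num) (lt_min (by positivity) (lt_min (by positivity) (by positivity))), min_le_left _ _,
      ?_, ?_, ?_⟩
    · have h1 : min (1 / 8) (min (l / (16 * a * (Rb + 1))) (min (1 / (32 * (Rb + 1) ^ 2)) (l * (S.a / 4) / (2 * a)))) ≤
        l / (16 * a * (Rb + 1)) := (min_le_right _ _).trans (min_le_left _ _)
      rwa [le_div_iff₀ (by positivity)] at h1
    · have h1 : min (1 / 8) (min (l / (16 * a * (Rb + 1))) (min (1 / (32 * (Rb + 1) ^ 2)) (l * (S.a / 4) / (2 * a)))) ≤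
        1 / (32 * (Rb + 1) ^ 2) := ((min_le_right _ _).trans (min_le_right _ _)).trans (min_le_left _ _)
      rw [le_div_iff₀ (by positivity)] at h1; nlinarith
    · have h1 : min (1 / 8) (min (l / (16 * a * (Rb + 1))) (min (1 / (32 * (Rb + 1) ^ 2)) (l * (S.a / 4) / (2 * a)))) ≤
        l * (S.a / 4) / (2 * a) := ((min_le_right _ _).trans (min_le_right _ _)).trans (min_le_right _ _)
      rwa [le_div_iff₀ (by positivity)] at h1
  -- the model
  have hmdT : ∀ z, (S.md s hs a l δ' ha0 hlpos hδ'pos hδ'le hl_a hδ'room hδ'up hδ'clean).T z =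
      a • e3 1 + l • frameOf S.norm_e S.e_two hs (z - S.x₀) := fun z ↦ rfl
  exact h.exists_isRegularNormalConnectedSum_isConcordant_of_strip G S s hs a l δ' ha0 hlpos hδ'pos hδ'le hl_a hδ'room
    hδ'up hδ'clean (by linarith) hl_ℓ hl_η (by linarith [ha.2]) F₁ F₂ (fun z hz ↦ by rw [hmdT]; exact hF₁ z hz) hR₁
    (fun z hz ↦ by rw [hmdT]; exact hF₂ z hz) hR₂ (fun z hz ↦ by rw [hmdT]; exact (hTW z hz).2)

end Knot.IsConicalConcordance

/-! ### The knot of the chart loop of a knot -/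

namespace IsChartLoop

open KnotsInBall

/-- **The knot of the chart loop of a knot off the south pole is the knot itself.** [folklore] -/
theorem toKnot_eq_of_eq_psi {K : Knot} (hK : ∀ x, K x ≠ southPole) {k : ℝ → EuclideanSpace ℝ (Fin 3)}
    (h : IsChartLoop k) (hk : k = fun θ ↦ psi (K (circlePt θ))) : h.toKnot = K := by
  apply SphereEmbedding.ext
  funext x
  rw [← circlePt_angA x]
  show h.toKnot (circlePt (angA x)) = K (circlePt (angA x))
  rw [h.toKnot_circlePt, hk]
  exact psi_symm_apply_psi (hK _)

end IsChartLoop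

/-! ### The discharge -/

namespace Knot

open KnotsInBall

/-- **Concordance is compatible with connected sum (both factors): discharge of the named fact
`Knot.exists_isConnectedSum_isConcordant`.** If `K₁ ~c K₁'` and `K₂ ~c K₂'` then some
connected sums `K₁ # K₂`, `K₁' # K₂'` are concordant: Fox–Milnor's carrying construction on both
factors (`exists_isRegularNormalConnectedSum_isConcordant_twoSided`), the second concordance
being straightened (`IsConcordant.exists_flat_longAnnulus`, `LongAnnulus.exists_flat_strip`) and
inverted (`StripPicture.Kn₁/Kn₂`, isotopic to the original ends). [cite: FoxMilnor1966, §1] -/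
theorem exists_isConnectedSum_isConcordant_holds : exists_isConnectedSum_isConcordant := by
  intro K₁ K₂ K₁' K₂' h₁ h₂
  -- the host: a conical representative of the first concordance with a good tube
  obtain ⟨f₀, hf₀⟩ := h₁
  obtain ⟨f, hf, δ, hδ, hδ4, hc₁, hc₂⟩ := hf₀.exists_conical
  have h : IsConicalConcordance K₁ K₁' f δ := ⟨hf, hδ, hδ4, hc₁, hc₂⟩
  obtain ⟨w, η, ε, G⟩ := h.exists_goodTube 0
  -- the second concordance: a long annulus with a flat strip
  obtain ⟨R, R', η₂, A, θ₁, ζ, x₀, e, hR, hR', hRp, hR'p, hk₁, hk₂, he2, hflat⟩ := h₂.exists_flat_longAnnulus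
  obtain ⟨D, hDk₁, hDk₂, δ₁, r', hδ₁, -, hr', hstrip, hbody⟩ := A.exists_flat_strip hflat
  let S : StripPicture D :=
    { x₀ := x₀
      e := e
      θ₁ := θ₁
      δ₁ := δ₁
      r' := min r' 1
      norm_e := hflat.norm_e
      e_two := he2
      δ₁_pos := hδ₁
      r'_pos := lt_min hr' one_pos
      r'_le := min_le_right _ _
      strip := fun θ s m hm ↦ by rw [hstrip θ s m hm, show θ - (m : ℝ) - θ₁ = θ - θ₁ - m by ring]
      bodyFree := fun θ s hlt ↦ hbody θ s (lt_of_lt_of_le hlt (min_le_left _ _)) }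
  obtain ⟨L, L', hL, hL', hc⟩ := h.exists_isRegularNormalConnectedSum_isConcordant_twoSided G S
  -- the inverted end knots are isotopic to the second summands
  have hRK : D.isChartLoop_k₁.toKnot = R := IsChartLoop.toKnot_eq_of_eq_psi hRp _ (hDk₁.trans hk₁)
  have hR'K : D.isChartLoop_k₂.toKnot = R' := IsChartLoop.toKnot_eq_of_eq_psi hR'p _ (hDk₂.trans hk₂)
  have hiso₁ : K₂.IsIsotopic S.Kn₁ := by
    have := S.isIsotopic_Kn₁
    rw [hRK] at this
    exact SphereEmbedding.IsIsotopic.trans_holds hR this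
  have hiso₂ : K₂'.IsIsotopic S.Kn₂ := by
    have := S.isIsotopic_Kn₂
    rw [hR'K] at this
    exact SphereEmbedding.IsIsotopic.trans_holds hR' this
  refine ⟨L, L', ?_, ?_, hc⟩
  · exact hL.isNormalConnectedSum.isConnectedSum.of_isIsotopic (SphereEmbedding.IsIsotopic.refl K₁)
      (SphereEmbedding.IsotopyFacts.symm hiso₁)
  · exact hL'.isNormalConnectedSum.isConnectedSum.of_isIsotopic (SphereEmbedding.IsIsotopic.refl K₁')
      (SphereEmbedding.IsotopyFacts.symm hiso₂)

end Knot

end Literature.Topology.FourManifolds
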